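import Summits.NavierStokesRegularity.NavierStokesRegularity.Theses.AxisymmetricExtremality
import Literature.Analysis.FluidPDE.AxisymmetricEuler
import Literature.Analysis.FluidPDE.RusinSverakCompactness
import Literature.Analysis.FluidPDE.SelfSimilarLiouville

/-!
# Strategist s10 — STRATEGY CENSUS sketch for crux `AxisymmetricKatoGlobal` (stmt-NavierStokesRegularity-15453)

Typed candidates examined in `STRATEGY-CENSUS-s10.md` (weaker intermediate, two decompositions,
one strengthening), each with the kernel-checked implication that shows where it sits relative to
the crux.  Nothing here is a registered line: every candidate leaves one piece that is the whole
crux (see the census).  No `sorry`.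
-/

noncomputable section

set_option linter.dupNamespace false

open MeasureTheory Set
open Literature.Analysis.FluidPDE Literature.Analysis.FunctionSpaces

namespace Summit.NavierStokesRegularity.NavierStokesRegularity.Cruxes.AxisymmetricKatoGlobal.StrategistS10

open Summit.NavierStokesRegularity.NavierStokesRegularity.Theses.AxisymmetricExtremality

/-- The data hypotheses of the crux, bundled: an `L³` field represented in `Ḣ^{1/2}`, weakly
divergence free, axisymmetric about the `x 2`-axis (equivariance written out as in the route file). -/
def IsAxCriticalDatum (u₀ : EuclideanSpace ℝ (Fin 3) → EuclideanSpace ℝ (Fin 3))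
    (g : HomSobolev (EuclideanSpace ℝ (Fin 3)) (EuclideanSpace ℂ (Fin 3)) (1 / 2 : ℝ)) : Prop :=
  MemLp u₀ 3 volume ∧ g.Represents (Literature.Analysis.FunctionSpaces.EuclideanSpace.complexify ∘ u₀) ∧
    IsWeaklyDivFree u₀ ∧
    ∀ (θ : ℝ) (x : EuclideanSpace ℝ (Fin 3)),
      u₀ (WithLp.toLp 2 ![Real.cos θ * x 0 - Real.sin θ * x 1, Real.sin θ * x 0 + Real.cos θ * x 1, x 2]) =
        WithLp.toLp 2 ![Real.cos θ * u₀ x 0 - Real.sin θ * u₀ x 1, Real.sin θ * u₀ x 0 + Real.cos θ * u₀ x 1, u₀ x 2]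

/-- The crux restated over the bundle (definitionally the route decl, reordered hypotheses). -/
theorem crux_iff :
    AxisymmetricKatoGlobal ↔
      ∀ ν : ℝ, 0 < ν → ∀ u₀ g, IsAxCriticalDatum u₀ g → HasGlobalKatoSolution ν u₀ := by
  constructor
  · intro h ν hν u₀ g ⟨h3, hrep, hdiv, hax⟩
    exact h ν hν u₀ g h3 hrep hdiv hax
  · intro h ν hν u₀ g h3 hrep hdiv hax
    exact h ν hν u₀ g ⟨h3, hrep, hdiv, hax⟩

/-! ## (1) Weaker intermediate: the weakest replacement `closes` will accept -/

/-- `W₀`: no `Ḣ^{1/2}`-minimal blow-up datum (Rusin–Šverák class `IsMinimalBlowupDatum`) is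
axisymmetric.  This is exactly what `closes` consumes from `h₃`. -/
def NoAxisymMinimalDatum : Prop :=
  ∀ ν : ℝ, 0 < ν → ¬ ∃ (u₀ : EuclideanSpace ℝ (Fin 3) → EuclideanSpace ℝ (Fin 3))
      (g : HomSobolev (EuclideanSpace ℝ (Fin 3)) (EuclideanSpace ℂ (Fin 3)) (1 / 2 : ℝ)),
    IsMinimalBlowupDatum ν u₀ g ∧
      ∀ (θ : ℝ) (x : EuclideanSpace ℝ (Fin 3)),
        u₀ (WithLp.toLp 2 ![Real.cos θ * x 0 - Real.sin θ * x 1, Real.sin θ * x 0 + Real.cos θ * x 1, x 2]) =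
          WithLp.toLp 2 ![Real.cos θ * u₀ x 0 - Real.sin θ * u₀ x 1, Real.sin θ * u₀ x 0 + Real.cos θ * u₀ x 1, u₀ x 2]

/-- The crux implies `W₀` (so `W₀` is weaker). -/
theorem noAxisymMinimalDatum_of_crux (h : AxisymmetricKatoGlobal) : NoAxisymMinimalDatum := by
  intro ν hν ⟨u₀, g, hmin, hax⟩
  obtain ⟨hL3, hrep, hdiv, -, hnot⟩ := hmin
  exact hnot (h ν hν u₀ g hL3 hrep hdiv hax)

/-- `W₀` already closes the route with the other two items (same pure logic as `closes`). -/
theorem closes_of_W0 (h₂ : MinimalDatumPFold) (h₄ : PFoldToAxisymmetric) (hW : NoAxisymMinimalDatum) :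
    NavierStokesRegularity := by
  show Literature.NS.NavierStokesExistenceSmoothR3
  intro ν hν u₀ hsm hdiv hdec
  by_contra hno
  exact hW ν hν (h₄ ν hν (h₂ ν hν ⟨u₀, hsm, hdiv, hdec, hno⟩))

/-- The surplus of the crux over `W₀`, made explicit: `W₀` holds as soon as EITHER the crux holds
OR no axisymmetric blow-up datum attains the unrestricted threshold `ρ_max^pure`.  (The second
disjunct — "symmetric data are never the most dangerous per unit `Ḣ^{1/2}` norm" — is the negation
of the mechanism the sibling crux `MinimalDatumPFold` bets on; see the census.) -/
theorem W0_of_threshold_gap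
    (h : ∀ ν : ℝ, 0 < ν → ∀ u₀ g, IsAxCriticalDatum u₀ g → ¬ HasGlobalKatoSolution ν u₀ →
      ‖g‖ₑ ≠ rusinSverakRhoMaxPure ν) :
    NoAxisymMinimalDatum := by
  intro ν hν ⟨u₀, g, hmin, hax⟩
  obtain ⟨hL3, hrep, hdiv, hnorm, hnot⟩ := hmin
  exact h ν hν u₀ g ⟨hL3, hrep, hdiv, hax⟩ hnot hnorm

/-! ## (2a) Decomposition by swirl size (regime split) -/

/-- Piece A(ε): scale-invariantly SMALL swirl, `|Γ₀| ≤ ε ν` pointwise (`Γ = x₀u₁ − x₁u₀ = r u_θ`,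
the tree's junk-free `swirl`), gives a global Kato solution.  Open for every absolute `ε`
(Lei–Zhang 2017 Thm 1.4 needs smallness relative to a data-dependent dimensionless `M₀`). -/
def SmallSwirlGlobal (ε : ℝ) : Prop :=
  ∀ ν : ℝ, 0 < ν → ∀ u₀ g, IsAxCriticalDatum u₀ g → (∀ x, |swirl u₀ x| ≤ ε * ν) →
    HasGlobalKatoSolution ν u₀

/-- Piece B(ε): the complementary regime (some point with `|Γ₀| > ε ν`, which includes `Γ₀ ∉ L^∞`). -/
def LargeSwirlGlobal (ε : ℝ) : Prop :=
  ∀ ν : ℝ, 0 < ν → ∀ u₀ g, IsAxCriticalDatum u₀ g → (∃ x, ε * ν < |swirl u₀ x|) →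
    HasGlobalKatoSolution ν u₀

/-- Assembly of the regime split (trivial seam: excluded middle on the swirl size). -/
theorem crux_of_swirlSplit (ε : ℝ) (hA : SmallSwirlGlobal ε) (hB : LargeSwirlGlobal ε) :
    AxisymmetricKatoGlobal := by
  rw [crux_iff]
  intro ν hν u₀ g hd
  by_cases hs : ∀ x, |swirl u₀ x| ≤ ε * ν
  · exact hA ν hν u₀ g hd hs
  · simp only [not_forall, not_le] at hs
    exact hB ν hν u₀ g hd hs

/-! ## (2b) Decomposition by the threshold IN the axisymmetric class (critical-element shape) -/

/-- An axisymmetric critical datum without global Kato solution whose `Ḣ^{1/2}` size is minimal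
among all such data (the in-class minimal blow-up datum). -/
def IsAxMinimalBlowupDatum (ν : ℝ) (u₀ : EuclideanSpace ℝ (Fin 3) → EuclideanSpace ℝ (Fin 3))
    (g : HomSobolev (EuclideanSpace ℝ (Fin 3)) (EuclideanSpace ℂ (Fin 3)) (1 / 2 : ℝ)) : Prop :=
  IsAxCriticalDatum u₀ g ∧ ¬ HasGlobalKatoSolution ν u₀ ∧
    ∀ u₁ g₁, IsAxCriticalDatum u₁ g₁ → ¬ HasGlobalKatoSolution ν u₁ → ‖g‖ₑ ≤ ‖g₁‖ₑ

/-- Piece C₁ (compactness / attainment): if some axisymmetric critical datum blows up, an in-class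
minimal one exists (Rusin–Šverák / Gallagher–Koch–Planchon profile machinery restricted to the
closed, scaling- and axis-translation-invariant axisymmetric class — plausibly provable with the
tree's `rusin_sverak_minimal_*` tools). -/
def AxThresholdAttained : Prop :=
  ∀ ν : ℝ, 0 < ν → (∃ u₀ g, IsAxCriticalDatum u₀ g ∧ ¬ HasGlobalKatoSolution ν u₀) →
    ∃ u₀ g, IsAxMinimalBlowupDatum ν u₀ g

/-- Piece C₂ (rigidity): no in-class minimal blow-up datum exists.  This piece is the whole crux
in disguise: minimality of the INITIAL norm is not propagated by the flow (no conserved or monotone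
critical quantity — `Literature.Barriers.NavierStokesRegularity.EnergySupercriticality`). -/
def AxThresholdRigidity : Prop :=
  ∀ ν : ℝ, 0 < ν → ¬ ∃ u₀ g, IsAxMinimalBlowupDatum ν u₀ g

/-- Assembly of the critical-element split. -/
theorem crux_of_threshold (hC₁ : AxThresholdAttained) (hC₂ : AxThresholdRigidity) :
    AxisymmetricKatoGlobal := by
  rw [crux_iff]
  intro ν hν u₀ g hd
  by_contra hno
  exact hC₂ ν hν (hC₁ ν hν ⟨u₀, g, hd, hno⟩)

/-- Conversely the crux gives both pieces (so neither is stronger than the crux). -/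
theorem threshold_pieces_of_crux (h : AxisymmetricKatoGlobal) :
    AxThresholdAttained ∧ AxThresholdRigidity := by
  rw [crux_iff] at h
  refine ⟨fun ν hν ⟨u₀, g, hd, hno⟩ => (hno (h ν hν u₀ g hd)).elim, fun ν hν ⟨u₀, g, hd, hno, _⟩ => ?_⟩
  exact hno (h ν hν u₀ g hd)

/-! ## (3) Strengthening examined: the axisymmetric KNSS Liouville conjecture with bounded swirl -/

/-- `S⁺_L`: bounded ancient mild solutions (KNSS class, `ν = 1`), axisymmetric at every time with
bounded swirl, are slice-wise constant.  KNSS 2009 p. 10 / Zhang's review arXiv:2101.04905 §3: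
open; known under `Γ ∈ L^∞_t L^p_x` (Lei–Zhang–Zhao 2017, PROVED in the tree), `z`-periodicity or a
plateau rate (Lei–Ren–Zhang 2019/21, PROVED in the tree), `|u| ≤ C/r` (KNSS Thm 5.3).  Even `S⁺_L`
would not give the crux: at a Type II point (Seregin 2020, all axisymmetric singular points) the
sup-normalised zoom-in limit may be the constant axial drift `c • e_z`, which `S⁺_L` allows. -/
def AxisymLiouvilleBoundedSwirl : Prop :=
  ∀ u : ℝ → EuclideanSpace ℝ (Fin 3) → EuclideanSpace ℝ (Fin 3), IsBoundedAncientMildSolution 1 u →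
    (∀ t < 0, AEStronglyMeasurable (u t) volume) → (∀ t < 0, IsAxisymmetric (u t)) →
    (∃ C : ℝ, ∀ t < 0, ∀ x, |swirl (u t) x| ≤ C) →
      ∀ t < 0, ∃ b : EuclideanSpace ℝ (Fin 3), u t =ᵐ[volume] fun _ => b

/-- `S⁺_L` is a special case of the (open) KNSS Liouville conjecture `LiouvilleConjectureNS`. -/
theorem axisymLiouville_of_liouvilleConjecture (h : LiouvilleConjectureNS) :
    AxisymLiouvilleBoundedSwirl :=
  fun u hu hmeas _ _ => h u hu hmeas

end Summit.NavierStokesRegularity.NavierStokesRegularity.Cruxes.AxisymmetricKatoGlobal.StrategistS10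

end
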